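import Literature.IUT.HodgeArakelov.MonoThetaCyclotomes
import Literature.IUT.HodgeArakelov.MonoThetaFromGroups
import Literature.IUT.HodgeArakelov.MonoThetaSymmetries
import Literature.IUT.HodgeArakelov.ThetaEvaluationSetting

/-!
# [IUTchII] §2, Definition 2.3 – Remark 2.4.1: `±`-label classes of cusps; `𝔽_l^{⋊±}`-symmetric two-torsion
# translates of cusps

Mochizuki, *Inter-universal Teichmüller theory II*, §2, kurims manuscript (Dec. 2020) pp. 67–71:
Definition 2.3 (i)–(v), Remark 2.3.1, Corollary 2.4 (i)–(iii), Remark 2.4.1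
[claim: Mochizuki2012, status: disputed] (IUTchII §2 Def 2.3 - Rmk 2.4.1, kurims pp.67-71). Record-only typing
under the claim key `Mochizuki2012` (D-0012, disputed); definitions and `Prop`-valued statements only.

* `IUTchII:Def2.3(i)` — `Δ_v := Δ^tp_{X̲̲_v}`, `Δ^±_v := Δ^tp_{X_v}`, `Π^±_v := Π^tp_{X_v}`, `Δ^cor_v`, `Π^cor_v := Π^tp_{C_v}`,
  their profinite completions, the two diagrams of (outer) inclusions, the indices `[Δ̂^±_v : Δ̂_v] = l`,
  `[Δ̂^cor_v : Δ̂^±_v] = 2l` (normal), and `Π^±_{v•} := N_{Π^±_v}(Π_{v•}) ⊆ Π^±_{v▶} := N_{Π^±_v}(Π_{v▶})` with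
  `Π^±_{v•}/Π_{v•} ≅ … ≅ Gal(X̲̲_v/X_v) (≅ ℤ/lℤ)` and `Π^±_{v•} ∩ Π_v = Π_{v•}` — DATA `PlusMinusTower`, normalisers
  DEFINED, printed equalities as named `Prop`s;
* `IUTchII:Def2.3(ii)` — cuspidal inertia groups (group-theoretic, [AbsTopI] Lem. 4.5) and their behaviour
  under `Π_⊆ ⊆ Π_⊇` (intersection / commensurators) — INTERFACE predicate `IsCuspidalInertia` + named `Prop`s;
* `IUTchII:Def2.3(iii)` — the `±`-label classes of cusps `LabCusp^±(Π_⊆)` DEFINED as a quotient (conjugacy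
  classes of cuspidal inertia subgroups modulo "commensurators `Π_⊇`-conjugate"), with the `𝔽_l^×`-action,
  the zero element `†η^0_v` and the `±`-canonical element `†η^±_v` as interface data ([IUTchI] Def. 6.1 (iii),
  TODO-merge:abc-iut-L5-t4);
* `IUTchII:Def2.3(iv)` — `t ↦` vertex of `Γ▶_X` `↦ Γ^{•t}_X ↦ Π_{v•t} ⊆ Π_{v▶}`, `Π^±_{v•t}` (DATA + normaliser
  DEFINED);
* `IUTchII:Def2.3(v)` — the `𝔽^±_l`-torsor structure on `LabCusp^±(Π_⊆)` for `Π_⊆ ∈ {Π^±_v, Π̂^±_v}` and the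
  outer isomorphism `Π_⊇/Π_⊆ ≅ 𝔽_l^{⋊±}` (DATA);
* `IUTchII:Rmk2.3.1` — `I ∩ Π_⊆ = I^l` for cuspidal inertia groups and strict `Π_⊆ ⊆ Π_⊇`; cuspidal inertia
  groups of `Π_v` are permuted by `Π^cor_v`-conjugation (named `Prop`s; the second PROVED from normality data);
* `IUTchII:Cor2.4(i)`–`(iii)` — with `Δ_{v□} := Δ_v ∩ Π_{v□}`, … (DEFINED) and the indices `2, l, 2l`: (i) the
  equivalence (a) `γ' ∈ Δ^±_{v□}` ⟺ (b) `I_t^{γγ'} ⊆ Π^γ_{v□}` ⟺ (c) `I_t^{γγ'} ⊆ (Π^±_{v□})^γ` (named fact;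
  printed proof 183 words via [IUTchI] Cor. 2.3/2.5, [CombGC] Prop. 1.2); (ii) the decomposition groups
  `D^δ_t := N(I^δ_t)`, `D^δ_{μ_-}`, `D^δ_{t,μ_-}` determined by an inclusion (DATA + compatibility `Prop`s);
  (iii) compatibility with `Π̂^cor_v`-conjugation (`𝔽_l^{⋊±}`-symmetry) (named `Prop`);
* `IUTchII:Rmk2.4.1` — replacing `I_t` by its maximal pro-`l'` subgroup: "every closed subgroup … is either
  open or trivial" (named `Prop` over a pro-`l'` interface).
-/

namespace Literature.IUT.HodgeArakelov

universe u

variable {S : BadPlaceSetting.{u}}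

/-! ## Definition 2.3 (i): the `±`- and `cor`-groups and their profinite completions -/

/-- **IUTchII:Def2.3(i)** (kurims p. 67), DATA over `Π_v ≅ Π^tp_{X̲̲_v}` with its Prop. 2.1 / 2.2 outputs:
"`Δ_v := Δ^tp_{X̲̲_v}`, `Δ^±_v := Δ^tp_{X_v}`, `Π^±_v := Π^tp_{X_v}`, `Δ^cor_v := Δ^tp_{C_v}`, `Π^cor_v := Π^tp_{C_v}`;
denote the respective profinite completions by means of a `∧`. Thus, we have natural diagrams of outer
inclusions `Δ_v → Δ^±_v → Δ^cor_v` over `Π_v → Π^±_v → Π^cor_v` [and the same with hats] … we recall that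
`Δ̂_v` [is] a normal open subgroup of `Δ̂^±_v` of index `l`, that `Δ̂^±_v` [is] a normal open subgroup of `Δ̂^cor_v`
of index `2l`, and that `Π^±_v` and `Π^cor_v` may be reconstructed group-theoretically from `Π_v` [cf. [EtTh],
Proposition 2.4]. We shall use these diagrams to regard the various groups … as subgroups, well-defined up
to `Π̂^cor_v`-conjugacy, of `Π̂^cor_v`." Typed with ALL groups as subgroups of the single ambient `Π̂^cor_v`
(as the text instructs), `Π^±_v` being the Prop. 2.1 group `Π^tp_{X_v}` embedded, the `Δ`'s the kernels of
the augmentation to `G_v`. [claim: Mochizuki2012, status: disputed] (IUTchII §2 Def 2.3 (i), kurims p.67) -/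
structure PlusMinusTower {P : TopGroup.{u}} (T : TemperedCoverings S P) : Type (u + 1) where
  /-- the ambient profinite group `Π̂^cor_v` -/
  Corhat : TopGroup.{u}
  /-- `Π^cor_v ⊆ Π̂^cor_v` (dense image of the tempered group; carried as a subgroup) -/
  cor : Subgroup Corhat
  /-- `Π̂^±_v`, `Π̂_v` -/
  pmHat : Subgroup Corhat
  hat : Subgroup Corhat
  /-- the embedding of `Π^±_v = Π^tp_{X_v}` (Prop. 2.1) into `Π̂^cor_v` -/
  emb : T.Xplain →* Corhat
  emb_injective : Function.Injective emb
  /-- the augmentation `Π̂^cor_v ↠ G_v` (its kernel is `Δ̂^cor_v`) -/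
  aug : Corhat →* S.Gk
  aug_surjective : Function.Surjective aug
  /-- containments of the printed diagrams -/
  hat_le_pmHat : hat ≤ pmHat
  emb_le_pmHat : emb.range ≤ pmHat
  embP_le_hat : (emb.comp T.incl).range ≤ hat
  embP_le_cor : emb.range ≤ cor
  [pmHat_normal : pmHat.Normal]
  /-- "`Δ̂_v` [is] a normal open subgroup of `Δ̂^±_v` of index `l`" -/
  deltaHat_normal : ((hat ⊓ aug.ker).subgroupOf (pmHat ⊓ aug.ker)).Normal
  deltaHat_index : ((hat ⊓ aug.ker).subgroupOf (pmHat ⊓ aug.ker)).index = S.l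
  /-- "`Δ̂^±_v` [is] a normal open subgroup of `Δ̂^cor_v` of index `2l`" -/
  deltaPmHat_normal : ((pmHat ⊓ aug.ker).subgroupOf aug.ker).Normal
  deltaPmHat_index : ((pmHat ⊓ aug.ker).subgroupOf aug.ker).index = 2 * S.l
  /-- compatibility of the augmentation with `Π_v ≅ Π_X(·) ↠ G` through some reference identification -/
  aug_compat : ∃ e : P ≃ₜ* S.PiX, ∀ x : P, aug (emb (T.incl x)) = S.aug (e x)

attribute [instance] PlusMinusTower.pmHat_normal

namespace PlusMinusTower

variable {P : TopGroup.{u}} {T : TemperedCoverings S P} (W : PlusMinusTower T)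

/-- `Π_v ⊆ Π̂^cor_v` (the image of `P`). [claim: Mochizuki2012, status: disputed] (IUTchII §2 Def 2.3 (i), kurims p.67) -/
abbrev piV : Subgroup W.Corhat := (W.emb.comp T.incl).range

/-- `Π^±_v ⊆ Π̂^cor_v` (the image of `Π^tp_{X_v}`). [claim: Mochizuki2012, status: disputed] (IUTchII §2 Def 2.3 (i), kurims p.67) -/
abbrev piPM : Subgroup W.Corhat := W.emb.range

/-- `Δ̂^cor_v := Ker(Π̂^cor_v ↠ G_v)`; `Δ_v, Δ^±_v, Δ^cor_v, Δ̂_v, Δ̂^±_v` are the intersections with it (DEFINED).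
[claim: Mochizuki2012, status: disputed] (IUTchII §2 Def 2.3 (i), kurims p.67) -/
abbrev deltaCorHat : Subgroup W.Corhat := W.aug.ker

/-- **IUTchII:Def2.3(i)** (kurims p. 67): `Π^±_{v□} := N_{Π^±_v}(Π_{v□})` for a subgroup `Π_{v□} ⊆ Π_v`
(DEFINED as the normaliser inside `Π^±_v`, all inside `Π̂^cor_v`). [claim: Mochizuki2012, status: disputed] (IUTchII §2 Def 2.3 (i), kurims p.67) -/
def pmNormalizer (H : Subgroup P) : Subgroup W.Corhat :=
  (Subgroup.normalizer (((H.map (W.emb.comp T.incl)).subgroupOf W.piPM : Subgroup W.piPM) :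
      Set W.piPM)).map W.piPM.subtype

end PlusMinusTower

/-- **IUTchII:Def2.3(i)** (kurims p. 67), the printed equalities for `□ ∈ {•, ▶}`: "natural isomorphisms
`Π^±_{v•}/Π_{v•} ≅ Π^±_{v▶}/Π_{v▶} ≅ Π^±_v/Π_v ≅ Δ̂^±_v/Δ̂_v ≅ Gal(X̲̲_v/X_v) (≅ ℤ/lℤ)` and equalities
`Π^±_{v•} ∩ Π_v = Π_{v•}`, `Π^±_{v▶} ∩ Π_v = Π_{v▶}` [cf. [IUTchI], Corollary 2.3, (iv)]". Typed as: for
`H ∈ {Π_{v•}, Π_{v▶}}`, `N_{Π^±_v}(H) ∩ Π_v = H` and `[N_{Π^±_v}(H) : H] = l = [Π^±_v : Π_v]`. PREDICATE on the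
Prop. 2.2 / Def. 2.3 (i) data `(Dec, W)`. [claim: Mochizuki2012, status: disputed] (IUTchII §2 Def 2.3 (i), kurims p.67) -/
def Def23_i_indices {P : TopGroup.{u}} {T : TemperedCoverings S P} {D : EtaleThetaData S.toThetaSetting P}
    (Dec : SubgraphDecomposition S T D) (W : PlusMinusTower T) : Prop :=
    ∀ H ∈ ({Dec.Pbullet, Dec.Ptri} : Set (Subgroup P)),
      W.pmNormalizer H ⊓ W.piV = H.map (W.emb.comp T.incl) ∧
      ((H.map (W.emb.comp T.incl)).subgroupOf (W.pmNormalizer H)).index = S.l ∧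
      (W.piV.subgroupOf W.piPM).index = S.l

/-! ## Definition 2.3 (ii): cuspidal inertia groups -/

/-- **IUTchII:Def2.3(ii)** (kurims pp. 67–68), INTERFACE: "the cuspidal inertia groups of `Π_⊇` may be
reconstructed group-theoretically from the topological group `Π_⊇` via the algorithms of [AbsTopI], Lemma 4.5
…; [AbsTopI], Proposition 4.10, (vi)", for `Π_⊇` any of `Π_v, Π^±_v, Π^cor_v, Π̂_v, Π̂^±_v, Π̂^cor_v`: carried as
a predicate on subgroups of the ambient `Π̂^cor_v`, indexed by which of the six groups is meant
(TODO-merge:abc-iut-L4-t4, [AbsTopI] Lem. 4.5). [claim: Mochizuki2012, status: disputed] (IUTchII §2 Def 2.3 (ii), kurims pp.67-68) -/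
structure CuspidalInertiaData {P : TopGroup.{u}} {T : TemperedCoverings S P} (W : PlusMinusTower T) :
    Type u where
  /-- `IsCuspidalInertia Π I`: `I` is a cuspidal inertia subgroup of the subgroup `Π ⊆ Π̂^cor_v` -/
  IsCuspidalInertia : Subgroup W.Corhat → Subgroup W.Corhat → Prop
  le_of_isCuspidalInertia : ∀ {Q I}, IsCuspidalInertia Q I → I ≤ Q

/-- **IUTchII:Def2.3(ii)** (kurims p. 68): "the cuspidal inertia groups of `Π_⊆` may be obtained as the
intersections with `Π_⊆` of those cuspidal inertia groups of `Π_⊇` that contain a finite index subgroup that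
lies inside `Π_⊆` [cf. [IUTchI], Corollary 2.5; Remark 2.5.2], while the cuspidal inertia groups of `Π_⊇` may
be obtained as the `Π_⊇`-conjugates of the commensurators [or, alternatively, the normalizers] in `Π_⊇` of
the cuspidal inertia groups of `Π_⊆` [cf. [CombGC], Proposition 1.2, (ii)]" — for `Π_⊆ ⊆ Π_⊇` among the
natural inclusions of (i). Named fact over the interface. [claim: Mochizuki2012, status: disputed] (IUTchII §2 Def 2.3 (ii), kurims p.68) -/
def Def23_ii {P : TopGroup.{u}} {T : TemperedCoverings S P} {W : PlusMinusTower T}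
    (C : CuspidalInertiaData W) (Qsub Qsup : Subgroup W.Corhat) : Prop :=
  Qsub ≤ Qsup ∧
  (∀ I, C.IsCuspidalInertia Qsub I ↔
      ∃ I', C.IsCuspidalInertia Qsup I' ∧ ((I' ⊓ Qsub).subgroupOf I').FiniteIndex ∧ I = I' ⊓ Qsub) ∧
  (∀ I', C.IsCuspidalInertia Qsup I' ↔
      ∃ I, C.IsCuspidalInertia Qsub I ∧ ∃ g ∈ Qsup,
        I' = ((Subgroup.normalizer ((I.subgroupOf Qsup : Subgroup Qsup) : Set Qsup)).map
          Qsup.subtype).map (MulAut.conj g).toMonoidHom)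

/-! ## Definition 2.3 (iii): `±`-label classes of cusps -/

/-- **IUTchII:Def2.3(iii)** (kurims p. 68): for `Π_⊆ ⊆ Π_⊇` as there (`Π_v ⊆ Π^±_v`, `Π^±_v ⊆ Π^±_v`, `Π̂_v ⊆ Π̂^±_v`,
`Π̂^±_v ⊆ Π̂^±_v`), "a `±`-label class of cusps of `Π_⊆` [is] the set of `Π_⊆`-conjugacy classes of cuspidal inertia
subgroups of `Π_⊆` whose commensurators in `Π_⊇` … determine a single `Π_⊇`-conjugacy class of subgroups in
`Π_⊇`. [… such a set of `Π_⊆`-conjugacy classes is, in fact, of cardinality one.]" The relation DEFINED on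
cuspidal inertia subgroups of `Π_⊆`: their normalisers in `Π_⊇` are `Π_⊇`-conjugate.
[claim: Mochizuki2012, status: disputed] (IUTchII §2 Def 2.3 (iii), kurims p.68) -/
def labelRel {P : TopGroup.{u}} {T : TemperedCoverings S P} {W : PlusMinusTower T}
    (C : CuspidalInertiaData W) (Qsub Qsup : Subgroup W.Corhat) :
    {I // C.IsCuspidalInertia Qsub I} → {I // C.IsCuspidalInertia Qsub I} → Prop :=
  fun I J => ∃ g ∈ Qsup,
    ((Subgroup.normalizer ((J.1.subgroupOf Qsup : Subgroup Qsup) : Set Qsup)).map Qsup.subtype) =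
      ((Subgroup.normalizer ((I.1.subgroupOf Qsup : Subgroup Qsup) : Set Qsup)).map Qsup.subtype).map
        (MulAut.conj g).toMonoidHom

/-- **IUTchII:Def2.3(iii)**: `LabCusp^±(Π_⊆)`, "the set of `±`-label classes of cusps of `Π_⊆`" (DEFINED as the
quotient by the equivalence closure of `labelRel`). [claim: Mochizuki2012, status: disputed] (IUTchII §2 Def 2.3 (iii), kurims p.68) -/
def LabCuspPM {P : TopGroup.{u}} {T : TemperedCoverings S P} {W : PlusMinusTower T}
    (C : CuspidalInertiaData W) (Qsub Qsup : Subgroup W.Corhat) : Type u :=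
  Quot (labelRel C Qsub Qsup)

/-- **IUTchII:Def2.3(iii)** (kurims p. 68), INTERFACE structure on `LabCusp^±(Π_v)`: "`LabCusp^±(Π_v) =
LabCusp^±(†𝒟_v)` admits a natural action by `𝔽_l^×`, as well as a zero element `†η^0_v` and a `±`-canonical
element `†η^±_v` — well-defined up to multiplication by `±1`, which may be constructed solely from `†𝒟_v`
[cf. [IUTchI], Definition 6.1, (iii)]" (when `Π_⊆ = Π_v`, `†𝒟_v := B^temp(Π_⊆)⁰`). TODO-merge:abc-iut-L5-t4
([IUTchI] Def. 6.1 (iii): `LabCusp`, `η`). [claim: Mochizuki2012, status: disputed] (IUTchII §2 Def 2.3 (iii), kurims p.68) -/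
structure LabCuspStructure {P : TopGroup.{u}} {T : TemperedCoverings S P} {W : PlusMinusTower T}
    (C : CuspidalInertiaData W) : Type u where
  /-- the natural `𝔽_l^×`-action on `LabCusp^±(Π_v)` -/
  act : (ZMod S.l)ˣ → LabCuspPM C W.piV W.piPM → LabCuspPM C W.piV W.piPM
  act_one : ∀ t, act 1 t = t
  act_mul : ∀ a b t, act (a * b) t = act a (act b t)
  /-- the zero element `†η^0_v` -/
  eta0 : LabCuspPM C W.piV W.piPM
  /-- the `±`-canonical element `†η^±_v`, "well-defined up to multiplication by `±1`" (a representative) -/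
  etaPM : LabCuspPM C W.piV W.piPM
  /-- `LabCusp^±(Π_v)` has `l` elements, identified with `𝔽_l` so that `†η^0_v ↦ 0`, `†η^±_v ↦ ±1` -/
  toFl : LabCuspPM C W.piV W.piPM ≃ ZMod S.l
  toFl_eta0 : toFl eta0 = 0
  toFl_etaPM : toFl etaPM = 1 ∨ toFl etaPM = -1
  toFl_act : ∀ (a : (ZMod S.l)ˣ) t, toFl (act a t) = (a : ZMod S.l) * toFl t

/-! ## Definition 2.3 (iv): `Π_{v•t}` -/

/-- **IUTchII:Def2.3(iv)** (kurims p. 68): "Let `t ∈ LabCusp^±(Π_v)`. Then `t` determines a unique vertex of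
`Γ▶_X` [cf. [CombGC], Proposition 1.5, (i)]. Write `Γ^{•t}_X ⊆ Γ▶_X` for the connected subgraph with no edges
whose unique vertex is the vertex determined by `t`. Then … `Γ^{•t}_X` determines — via a functorial
group-theoretic algorithm — a decomposition group `Π_{v•t} ⊆ Π_{v▶} ⊆ Π_v` — which is well-defined up to
`Π_{v▶}`-conjugacy. Finally, … `Π^±_{v•t} := N_{Π^±_v}(Π_{v•t})`; thus, we have a natural isomorphism
`Π^±_{v•t}/Π_{v•t} ≅ Gal(X̲̲_v/X_v)`." DATA: the vertex map (valued in the labels `ℤ/lℤ` of `Γ_X`, Rmk. 2.1.1 (ii)),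
and `t ↦ Π_{v•t}`, with `Π_{v•(zero)} = Π_{v•}`. [claim: Mochizuki2012, status: disputed] (IUTchII §2 Def 2.3 (iv), kurims p.68) -/
structure LabelledDecomposition {P : TopGroup.{u}} {T : TemperedCoverings S P}
    {D : EtaleThetaData S.toThetaSetting P} (Dec : SubgraphDecomposition S T D) {W : PlusMinusTower T}
    {C : CuspidalInertiaData W} (L : LabCuspStructure C) : Type u where
  /-- `t ↦` the vertex of `Γ▶_X` it determines ([CombGC] Prop. 1.5 (i)), as a label in `ℤ/lℤ` -/
  vertex : LabCuspPM C W.piV W.piPM → ZMod S.l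
  vertex_eq : ∀ t, vertex t = L.toFl t
  /-- `t ↦ Π_{v•t} ⊆ Π_{v▶}` -/
  Pbt : LabCuspPM C W.piV W.piPM → Subgroup P
  Pbt_le : ∀ t, Pbt t ≤ Dec.Ptri
  /-- at the zero label, `Π_{v•t} = Π_{v•}` -/
  Pbt_zero : Pbt L.eta0 = Dec.Pbullet

/-- **IUTchII:Def2.3(iv)**: `Π^±_{v•t} := N_{Π^±_v}(Π_{v•t})` (DEFINED). [claim: Mochizuki2012, status: disputed] (IUTchII §2 Def 2.3 (iv), kurims p.68) -/
abbrev LabelledDecomposition.pmPbt {P : TopGroup.{u}} {T : TemperedCoverings S P}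
    {D : EtaleThetaData S.toThetaSetting P} {Dec : SubgraphDecomposition S T D} {W : PlusMinusTower T}
    {C : CuspidalInertiaData W} {L : LabCuspStructure C} (Ld : LabelledDecomposition Dec L)
    (t : LabCuspPM C W.piV W.piPM) : Subgroup W.Corhat :=
  W.pmNormalizer (Ld.Pbt t)

/-! ## Definition 2.3 (v): the `𝔽^±_l`-torsor structure and `Π_⊇/Π_⊆ ≅ 𝔽_l^{⋊±}` -/

/-- **IUTchII:Def2.3(v)** (kurims p. 69): for `Π_⊆ ∈ {Π^±_v, Π̂^±_v}` with `Π_⊇ := Π^cor_v`, resp. `Π̂^cor_v`, "the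
images … in `LabCusp^±(Π_⊆)` of the various structures on `LabCusp^±(Π_v)` reviewed in (iii) determine [in the
notation and terminology of [IUTchI], Definition 6.1, (i)] a natural `𝔽^±_l`-torsor structure on
`LabCusp^±(Π_⊆)`. Moreover, the natural action of `Π_⊇/Π_⊆` on `Π_⊆` preserves this `𝔽^±_l`-torsor structure,
hence determines a natural outer isomorphism `Π_⊇/Π_⊆ ≅ 𝔽_l^{⋊±}`." DATA (hatted case, inside `Π̂^cor_v`): the
identification `LabCusp^±(Π̂^±_v) ≅ 𝔽_l` up to the `𝔽^±_l`-torsor ambiguity and the isomorphism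
`Π̂^cor_v/Π̂^±_v ≅ 𝔽_l^{⋊±}` (the tree's `Literature.IUT.HodgeTheaters.FlPM`, L5-t4) compatible with the action on
labels.
[claim: Mochizuki2012, status: disputed] (IUTchII §2 Def 2.3 (v), kurims p.69) -/
structure FlTorsorStructure {P : TopGroup.{u}} {T : TemperedCoverings S P} {W : PlusMinusTower T}
    (C : CuspidalInertiaData W) : Type u where
  /-- `LabCusp^±(Π̂^±_v) ≅ 𝔽_l` (one chart of the `𝔽^±_l`-torsor structure) -/
  chart : LabCuspPM C W.pmHat W.pmHat ≃ ZMod S.l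
  /-- the outer isomorphism `Π̂^cor_v/Π̂^±_v ≅ 𝔽_l^{⋊±}` -/
  quotIso : W.Corhat ⧸ W.pmHat ≃* Literature.IUT.HodgeTheaters.FlPM S.l
  /-- the conjugation action of `Π̂^cor_v` on label classes -/
  conjAct : W.Corhat → LabCuspPM C W.pmHat W.pmHat → LabCuspPM C W.pmHat W.pmHat
  /-- "the natural action of `Π_⊇/Π_⊆` on `Π_⊆` preserves this `𝔽^±_l`-torsor structure": through the chart,
  `g` acts on labels by the affine map `x ↦ ± x + a` given by `quotIso g = (a, ±1)` -/
  conjAct_chart : ∀ (g : W.Corhat) (t : LabCuspPM C W.pmHat W.pmHat),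
    chart (conjAct g t) =
      Multiplicative.toAdd (quotIso (QuotientGroup.mk g)).left +
        ((quotIso (QuotientGroup.mk g)).right : ℤ) * chart t

/-- **IUTchII:Def2.3(iii)**–**(v)** existence (kurims pp. 68–69: "one verifies immediately"): the label-class
structures exist over the group-theoretic data. PREDICATE on `(Dec, C)`. [claim: Mochizuki2012, status: disputed] (IUTchII §2 Def 2.3 (v), kurims p.69) -/
def Def23_structures {P : TopGroup.{u}} {T : TemperedCoverings S P} {D : EtaleThetaData S.toThetaSetting P}
    (Dec : SubgraphDecomposition S T D) {W : PlusMinusTower T} (C : CuspidalInertiaData W) : Prop :=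
  ∃ (L : LabCuspStructure C), Nonempty (LabelledDecomposition Dec L) ∧ Nonempty (FlTorsorStructure C)

/-! ## Remark 2.3.1 -/

/-- **IUTchII:Rmk2.3.1** (kurims p. 69): "In the situation of (iii), suppose that the inclusion `Π_⊆ ⊆ Π_⊇` is
strict. Then … if `I ⊆ Π_⊇` is a cuspidal inertia group of `Π_⊇`, then the cuspidal inertia group
`I ∩ Π_⊆ ⊆ Π_⊆` of `Π_⊆` satisfies `I ∩ Π_⊆ = I^l` — where the superscript `l` is relative to the group operation
on `I`, written multiplicatively." Named `Prop` over the interface (`I^l` = the subgroup generated by `l`-th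
powers of elements of `I`). [claim: Mochizuki2012, status: disputed] (IUTchII §2 Rmk 2.3.1, kurims p.69) -/
def Rmk231_powers {P : TopGroup.{u}} {T : TemperedCoverings S P} {W : PlusMinusTower T}
    (C : CuspidalInertiaData W) (Qsub Qsup : Subgroup W.Corhat) : Prop :=
  Qsub < Qsup → ∀ I, C.IsCuspidalInertia Qsup I →
    I ⊓ Qsub = Subgroup.closure ((fun x : W.Corhat => x ^ S.l) '' (I : Set W.Corhat))

/-- **IUTchII:Rmk2.3.1** (kurims p. 69), second claim: "[even though `Π_v` … fails to be normal in `Π^cor_v` …]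
it follows — since `Π^±_v` … is normal in `Π^cor_v` … — that the cuspidal inertia groups of `Π_v` … are permuted
by the conjugation action of `Π^cor_v`". PROVED in the abstract form the printed argument uses: if the cuspidal
inertia groups of `Π_v` are exactly the `I^l` for `I` cuspidal in the NORMAL subgroup `Π^±`, and those of `Π^±`
are permuted by conjugation, then so are those of `Π_v`. [claim: Mochizuki2012, status: disputed] (IUTchII §2 Rmk 2.3.1, kurims p.69) -/
theorem Rmk231_permuted {G : Type u} [Group G] (cuspPM cuspV : Set (Subgroup G)) (l : ℕ)
    (hPM : ∀ g : G, ∀ I ∈ cuspPM, I.map (MulAut.conj g).toMonoidHom ∈ cuspPM)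
    (hV : ∀ J, J ∈ cuspV ↔ ∃ I ∈ cuspPM, J = Subgroup.closure ((fun x : G => x ^ l) '' (I : Set G)))
    (g : G) (J : Subgroup G) (hJ : J ∈ cuspV) : J.map (MulAut.conj g).toMonoidHom ∈ cuspV := by
  obtain ⟨I, hI, rfl⟩ := (hV J).mp hJ
  refine (hV _).mpr ⟨I.map (MulAut.conj g).toMonoidHom, hPM g I hI, ?_⟩
  rw [MonoidHom.map_closure, Subgroup.coe_map, ← Set.image_comp, ← Set.image_comp]
  congr 1
  ext x
  simp

/-! ## Corollary 2.4: `𝔽_l^{⋊±}`-symmetric two-torsion translates of cusps -/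

/-! ### `Δ_{v□}, Π^±_{v□}, Π_{v□̈}, …` for a subgroup `Π_{v□} ⊆ Π_v` -/

namespace PlusMinusTower

variable {P : TopGroup.{u}} {T : TemperedCoverings S P} (W : PlusMinusTower T) (H : Subgroup P)

/-- **IUTchII:Cor2.4** preamble (kurims p. 69), for `□ ∈ {•t, ▶}` (any subgroup `Π_{v□} ⊆ Π_v`, given in `P`):
`Π_{v□}` inside `Π̂^cor_v` (DEFINED). [claim: Mochizuki2012, status: disputed] (IUTchII §2 Cor 2.4, kurims p.69) -/
abbrev box : Subgroup W.Corhat := H.map (W.emb.comp T.incl)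

/-- `Δ_{v□} := Δ_v ∩ Π_{v□}` (DEFINED). [claim: Mochizuki2012, status: disputed] (IUTchII §2 Cor 2.4, kurims p.69) -/
abbrev deltaBox : Subgroup W.Corhat := W.box H ⊓ W.aug.ker

/-- `Π^±_{v□} := N_{Π^±_v}(Π_{v□})` (DEFINED, = `pmNormalizer`). [claim: Mochizuki2012, status: disputed] (IUTchII §2 Cor 2.4, kurims p.69) -/
abbrev pmBox : Subgroup W.Corhat := W.pmNormalizer H

/-- `Δ^±_{v□} := Δ^±_v ∩ Π^±_{v□}` (DEFINED). [claim: Mochizuki2012, status: disputed] (IUTchII §2 Cor 2.4, kurims p.69) -/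
abbrev deltaPmBox : Subgroup W.Corhat := W.pmNormalizer H ⊓ W.aug.ker

/-- `Π_{v□̈} := Π_{v□} ∩ Π^tp_{Ÿ̲_v}` (DEFINED). [claim: Mochizuki2012, status: disputed] (IUTchII §2 Cor 2.4, kurims p.69) -/
abbrev boxDd : Subgroup W.Corhat := (H ⊓ T.YddL).map (W.emb.comp T.incl)

/-- `Δ_{v□̈} := Δ_v ∩ Π_{v□̈}` (DEFINED). [claim: Mochizuki2012, status: disputed] (IUTchII §2 Cor 2.4, kurims p.69) -/
abbrev deltaBoxDd : Subgroup W.Corhat := W.boxDd H ⊓ W.aug.ker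

end PlusMinusTower

/-- **IUTchII:Cor2.4** preamble, the indices (kurims p. 69): "`[Π_{v□} : Π_{v□̈}] = [Δ_{v□} : Δ_{v□̈}] = 2`,
`[Π^±_{v□} : Π_{v□}] = [Δ^±_{v□} : Δ_{v□}] = l`, `[Π^±_{v□} : Π_{v□̈}] = [Δ^±_{v□} : Δ_{v□̈}] = 2l` [cf. Definition 2.3,
(i), (iv)]", for `Π_{v□}` one of the decomposition groups `Π_{v•t}`, `Π_{v▶}`. Named fact.
[claim: Mochizuki2012, status: disputed] (IUTchII §2 Cor 2.4, kurims p.69) -/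
def Cor24_indices {P : TopGroup.{u}} {T : TemperedCoverings S P} (W : PlusMinusTower T)
    (H : Subgroup P) : Prop :=
  ((W.boxDd H).subgroupOf (W.box H)).index = 2 ∧ ((W.deltaBoxDd H).subgroupOf (W.deltaBox H)).index = 2 ∧
  ((W.box H).subgroupOf (W.pmBox H)).index = S.l ∧ ((W.deltaBox H).subgroupOf (W.deltaPmBox H)).index = S.l ∧
  ((W.boxDd H).subgroupOf (W.pmBox H)).index = 2 * S.l ∧
  ((W.deltaBoxDd H).subgroupOf (W.deltaPmBox H)).index = 2 * S.l

/-- **IUTchII:Cor2.4(i)** (kurims pp. 69–70) "(Inclusions and Conjugates)": "Let `I_t ⊆ Π_v` be a cuspidal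
inertia group that belongs to the class determined by `t` such that `I_t ⊆ Δ_{v□}`. Consider the [`Π̂^±_v`-
conjugacy stable] sets of subgroups `{I_t^{γ₁}}`, `{Π^{γ₂}_{v□}}`, `{(Π^±_{v□})^{γ₃}}` (`γ_i ∈ Π̂^±_v`, equivalently
`∈ Δ̂^±_v`) … Then for `γ, γ' ∈ Δ̂^±_v`, the following three conditions are equivalent: (a) `γ' ∈ Δ^±_{v□}`; (b)
`I_t^{γγ'} ⊆ Π^γ_{v□}`; (c) `I_t^{γγ'} ⊆ (Π^±_{v□})^γ`." Named fact over the data (printed proof, 183 words, via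
[IUTchI] Cor. 2.3 (v), (vi), Cor. 2.5, [CombGC] Prop. 1.2 (ii)), for `Π_{v□}` a decomposition group
`Π_{v•t}` or `Π_{v▶}` and `I` a cuspidal inertia group of `Π_v` of label `t` inside `Δ_{v□}`.
[claim: Mochizuki2012, status: disputed] (IUTchII §2 Cor 2.4 (i), kurims pp.69-71) -/
def Cor24_i {P : TopGroup.{u}} {T : TemperedCoverings S P} (W : PlusMinusTower T)
    (C : CuspidalInertiaData W) (H : Subgroup P) (I : Subgroup W.Corhat) : Prop :=
  C.IsCuspidalInertia W.piV I → I ≤ W.deltaBox H →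
    ∀ γ γ' : W.Corhat, γ ∈ W.pmHat ⊓ W.aug.ker → γ' ∈ W.pmHat ⊓ W.aug.ker →
      (γ' ∈ W.deltaPmBox H ↔
        I.map (MulAut.conj (γ * γ')).toMonoidHom ≤ (W.box H).map (MulAut.conj γ).toMonoidHom) ∧
      (I.map (MulAut.conj (γ * γ')).toMonoidHom ≤ (W.box H).map (MulAut.conj γ).toMonoidHom ↔
        I.map (MulAut.conj (γ * γ')).toMonoidHom ≤ (W.pmBox H).map (MulAut.conj γ).toMonoidHom)

/-- **IUTchII:Cor2.4(ii)** (kurims p. 70) "(Two-torsion Translates of Cusps)", DATA determined by an inclusion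
`I^δ_t ⊆ Π^δ_{v□}` (`δ = γγ' ∈ Δ̂^±_v`): "(a) a decomposition group `D^δ_t := N_{Π^δ_v}(I^δ_t) ⊆ Π^δ_{v□̈}`
corresponding to the inertia group `I^δ_t`; (b) a decomposition group `D^δ_{μ_-} ⊆ Π^δ_{v▶̈}`, well-defined up to
`(Π^±_{v▶})^δ`-conjugacy, corresponding to the torsion point `μ_-` of Remark 1.4.1 … via [SemiAnbd], Theorem 6.8,
(iii) … and Corollary 3.11 …; (c) a decomposition group `D^δ_{t,μ_-} ⊆ Π^δ_{v□̈}`, well-defined up to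
`(Π^±_{v□})^δ`-conjugacy — i.e., the image of an evaluation section [cf. [IUTchI], Example 4.4, (i)] —
corresponding to the `μ_-`-translate of the cusp that gives rise to `I^δ_t` …". (a) DEFINED as the normaliser;
(b), (c) carried as data; TODO-merge:abc-iut-L3-t4 ([SemiAnbd] Thm. 6.8 (iii)).
[claim: Mochizuki2012, status: disputed] (IUTchII §2 Cor 2.4 (ii), kurims p.70) -/
structure TwoTorsionTranslates {P : TopGroup.{u}} {T : TemperedCoverings S P} (W : PlusMinusTower T)
    (H : Subgroup P) (I : Subgroup W.Corhat) (δ : W.Corhat) : Type u where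
  /-- the given inclusion `I^δ_t ⊆ Π^δ_{v□}` -/
  incl : I.map (MulAut.conj δ).toMonoidHom ≤ (W.box H).map (MulAut.conj δ).toMonoidHom
  /-- (b) `D^δ_{μ_-}` and (c) `D^δ_{t,μ_-}` -/
  Dmu : Subgroup W.Corhat
  Dtmu : Subgroup W.Corhat
  Dtmu_le : Dtmu ≤ (W.boxDd H).map (MulAut.conj δ).toMonoidHom

/-- **IUTchII:Cor2.4(ii)** (a): `D^δ_t := N_{Π^δ_v}(I^δ_t)`, the decomposition group of the cusp (DEFINED).
[claim: Mochizuki2012, status: disputed] (IUTchII §2 Cor 2.4 (ii), kurims p.70) -/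
def TwoTorsionTranslates.Dt {P : TopGroup.{u}} {T : TemperedCoverings S P} {W : PlusMinusTower T}
    {H : Subgroup P} {I : Subgroup W.Corhat} {δ : W.Corhat}
    (_X : TwoTorsionTranslates W H I δ) : Subgroup W.Corhat :=
  (Subgroup.normalizer (((I.map (MulAut.conj δ).toMonoidHom).subgroupOf
      (W.piV.map (MulAut.conj δ).toMonoidHom) : Subgroup (W.piV.map (MulAut.conj δ).toMonoidHom)) :
        Set (W.piV.map (MulAut.conj δ).toMonoidHom))).map
    (W.piV.map (MulAut.conj δ).toMonoidHom).subtype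

/-- **IUTchII:Cor2.4(ii)** (completeness/compatibility) and **IUTchII:Cor2.4(iii)** (kurims p. 70): "any inclusion `I^δ_t ⊆ Π^δ_{v□}` as in (i) completely
determines the [data (a), (b), (c)] … the construction of the above data is compatible with conjugation by
arbitrary `δ ∈ Δ̂^±_v`, as well as with the natural inclusion `Π_{v•t} ⊆ Π_{v▶}` … (iii) Suppose that `□ = •t`.
Then the construction of the data of (ii), (a), (c), is compatible with conjugation by arbitrary
`δ ∈ Π̂^cor_v` [cf. Remark 2.3.1] (`𝔽_l^{⋊±}`-symmetry; `Δ̂^cor_v/Δ̂^±_v ≅ Π̂^cor_v/Π̂^±_v ≅ 𝔽_l^{⋊±}`)." Typed as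
the existence of an ASSIGNMENT `(I, δ) ↦` data with `D^δ_t ⊆ Π^δ_{v□̈}`, equivariant under conjugation by
`Δ̂^cor_v` (case `□ = •t`). Named fact. [claim: Mochizuki2012, status: disputed] (IUTchII §2 Cor 2.4 (ii)(iii), kurims p.70) -/
def Cor24_ii_iii {P : TopGroup.{u}} {T : TemperedCoverings S P} (W : PlusMinusTower T)
    (C : CuspidalInertiaData W) (H : Subgroup P) : Prop :=
  ∃ data : ∀ (I : Subgroup W.Corhat) (δ : W.Corhat),
      I.map (MulAut.conj δ).toMonoidHom ≤ (W.box H).map (MulAut.conj δ).toMonoidHom →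
        TwoTorsionTranslates W H I δ,
    (∀ I δ h, (data I δ h).Dt ≤ (W.boxDd H).map (MulAut.conj δ).toMonoidHom) ∧
    ∀ (I : Subgroup W.Corhat) (δ ε : W.Corhat) (h : _) (h' : _),
      C.IsCuspidalInertia W.piV I → ε ∈ W.aug.ker →
        (data I (ε * δ) h').Dtmu = ((data I δ h).Dtmu).map (MulAut.conj ε).toMonoidHom

/-- **IUTchII:Rmk2.4.1** (kurims p. 71): "one may replace `I_t` in Corollary 2.4 by its maximal pro-`l'`
subgroup for any `l' ∈ Primes \ {p_v}`. The use of such maximal pro-`l'` subgroups sometimes results in a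
simplification …, since every closed subgroup of such a maximal pro-`l'` subgroup is either open or trivial."
Typed: the dichotomy for subgroups of a group `I'` abstractly isomorphic to `ℤ_{l'}` (carried as: every
nontrivial subgroup has finite index). Named `Prop` with the pro-`l'` group as parameter.
[claim: Mochizuki2012, status: disputed] (IUTchII §2 Rmk 2.4.1, kurims p.71) -/
def Rmk241_openOrTrivial {G : Type u} [Group G] (I' : Subgroup G) : Prop :=
  ∀ K : Subgroup G, K ≤ I' → K = ⊥ ∨ (K.subgroupOf I').FiniteIndex

end Literature.IUT.HodgeArakelov
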